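import Literature.AlgebraicGeometry.Resolution.NodeFittingIdeal
import Literature.RingTheory.FittingIdeal.Localization
import Mathlib.RingTheory.Kaehler.TensorProduct
import Mathlib.RingTheory.Unramified.LocalRing
import Mathlib.RingTheory.Jacobson.Ring
import Mathlib.RingTheory.RegularLocalRing.Defs
import Mathlib.FieldTheory.IsAlgClosed.Basic
import Mathlib.RingTheory.Localization.AtPrime.Basic
import HarnessLib

/-!
# `Sing(f) → S` is unramified: the ring-level statement (de Jong 1996, 2.21; Stacks 0C4D, 0C3I)

Topic: `Literature/AlgebraicGeometry/Resolution`. Ring-theoretic core of the discharge of the named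
fact `DeJong1996SingUnramified` (`AlterationsSingFitting.lean`; de Jong 1996, 2.21: "Let
`Sing(f) ⊂ X` be the closed subscheme defined by the first Fitting ideal of the sheaf `Ω_{X/S}`.
The morphism `Sing(f) → S` is finite, unramified and of finite presentation" — the clause
UNRAMIFIED). On an affine chart `Spec T → Spec R` of `f`, with `J = Fitt₁(Ω_{T/R})` the ideal of
`Sing(f)`, a prime `𝔮 ⊇ J` of `T` over `𝔭 ⊂ R`, and the GEOMETRIC fibre ring `A = K ⊗_R T` over
an algebraically closed field `K ⊇ κ(𝔭)`, the hypothesis is the fibre condition of a semi-stable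
curve read on `A` (every maximal ideal of `A` is a nonsingular point of a curve or an ordinary
double point, `NodeFittingIdeal.lean`), and the conclusion is that `T/J` is unramified over `R`
at `𝔮` (Mathlib `Algebra.IsUnramifiedAt`), whence — Stacks 00UW/02FM, Mathlib
`Algebra.isUnramifiedAt_iff_map_eq` — `𝔮 T_𝔮 ⊆ J T_𝔮 + 𝔭 T_𝔮` and `κ(𝔮)/κ(𝔭)` separable. All
PROVED; the architecture (Stacks 0C4D for general `k`: "the formation of `Z = V(Fitt₁)` commutes
with field extension … `Z_{k̄}` is `x̄` with multiplicity `1` … hence `Z` is geometrically reduced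
at `x` … `κ(x)/k` separable") is rendered as:

* `Module.fittingIdeal_kaehlerDifferential_of_isPushout` — **Stacks 0C3I at rings**: the Fitting
  ideals of `Ω` commute with base change of the base, `Fitt_k(Ω_{A/K}) = Fitt_k(Ω_{T/R}) A` for a
  pushout square (`KaehlerDifferential.tensorKaehlerEquiv` and `Module.fittingIdeal_baseChange`);
* `exists_mul_mem_fittingIdeal_of_isMaximal` — at a nodal-or-regular maximal ideal `M` of a
  finite type algebra `A` over `K = K̄`: `M A_M ⊆ Fitt₁(Ω_{A/K}) A_M` (layer A,
  `NodeFittingIdeal.lean`, with the Nullstellensatz `A/M = K`); hence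
  `isMaximal_of_fittingIdeal_le` — every prime of `A` containing `Fitt₁(Ω_{A/K})` is maximal, and
  `algebraMap_surjective_of_fittingIdeal_le_ker` — `K → D'_Q` is onto for any `K`-algebra
  surjection `A → D'` killing `Fitt₁` and any prime `Q` of `D'` (the singular scheme of the
  geometric fibre is a disjoint union of reduced `K`-points);
* `Algebra.isUnramifiedAt_of_formallyUnramified_localization` — **unramifiedness descends from a
  geometric point**: for an `R`-algebra `D` essentially of finite type, a base change
  `D_K = K ⊗_R D` and a prime `Q` of `D_K` over `𝔮`, if `(D_K)_Q` is formally unramified over `K`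
  then `D` is unramified over `R` at `𝔮` (`Ω_{D_K/K} = D_K ⊗_D Ω_{D/R}`, localisation, and
  Nakayama through the residue field of `(D_K)_Q`, a field extension of `κ(𝔮)` — no flatness is
  needed);
* `exists_isPrime_comap_includeRight_eq` — every prime of `T` over `𝔭` lies under a prime of
  `K ⊗_R T` for a field `K ⊇ κ(𝔭)`;
* `isUnramifiedAt_map_mk_fittingIdeal` — THE RING-LEVEL STATEMENT: `T/J` is unramified over
  `R` at `𝔮/J`; and its two consequences in the form consumed by the scheme-level assembly,
  `exists_mul_mem_fittingIdeal_sup_of_geometricFibre` (`∀ y ∈ 𝔮, ∃ s ∉ 𝔮, s y ∈ J + 𝔭T`) and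
  `isSeparable_residueField_of_geometricFibre` (`κ(𝔮)/κ(𝔭)` separable).

## Sources

* A. J. de Jong, *Smoothness, semi-stability and alterations*, Publ. Math. IHÉS 83 (1996), 2.21,
  2.23 (pp. 61–62). [DeJong1996]
* The Stacks Project, Tags 0C4D, 0C3I, 0C59, 00UW, 02FM. [StacksProject]
-/

noncomputable section

namespace Literature.AlgebraicGeometry.Resolution

open IsLocalRing Literature.RingTheory.FittingIdeal TensorProduct

universe u v w

/-! ## Stacks 0C3I at rings: `Fitt_k(Ω)` commutes with base change of the base -/

/-- **The formation of `Sing = V(Fitt Ω)` commutes with base change** (Stacks 0C3I), at rings: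
for a pushout square `R → K`, `T → A = K ⊗_R T` and `Ω_{T/R}` finite,
`Fitt_k(Ω_{A/K}) = Fitt_k(Ω_{T/R}) · A` (`Ω_{A/K} = A ⊗_T Ω_{T/R}` and Fitting ideals commute with
base change, Stacks 07ZA (3)). [cite: StacksProject, Tag 0C3I] -/
theorem Module.fittingIdeal_kaehlerDifferential_of_isPushout (R : Type u) (K : Type v)
    (T : Type w) (A : Type*) [CommRing R] [CommRing K] [CommRing T] [CommRing A] [Algebra R K]
    [Algebra R T] [Algebra K A] [Algebra T A] [Algebra R A] [IsScalarTower R K A]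
    [IsScalarTower R T A] [Algebra.IsPushout R K T A] [Module.Finite T (Ω[T⁄R])] (k : ℕ) :
    Module.fittingIdeal A (Ω[A⁄K]) k = (Module.fittingIdeal T (Ω[T⁄R]) k).map (algebraMap T A) := by
  rw [← Module.fittingIdeal_eq_of_linearEquiv (KaehlerDifferential.tensorKaehlerEquiv R K T A) k,
    Module.fittingIdeal_baseChange]

/-! ## Extended ideals in a localisation at a prime -/

/-- Membership in an extended ideal of `A_M`: `y/1 ∈ I A_M ↔ ∃ t ∉ M, t y ∈ I`. [folklore] -/
theorem IsLocalization.AtPrime.algebraMap_mem_map_iff {A : Type u} {B : Type v} [CommRing A]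
    [CommRing B] [Algebra A B] (M : Ideal A) [M.IsPrime] [IsLocalization.AtPrime B M]
    (I : Ideal A) (y : A) :
    algebraMap A B y ∈ I.map (algebraMap A B) ↔ ∃ t ∉ M, t * y ∈ I := by
  constructor
  · intro h
    obtain ⟨⟨⟨i, hi⟩, ⟨m, hm⟩⟩, himy⟩ := (IsLocalization.mem_map_algebraMap_iff M.primeCompl B).mp h
    simp only at himy
    rw [← map_mul] at himy
    obtain ⟨⟨c, hc⟩, hcc⟩ := (IsLocalization.eq_iff_exists M.primeCompl B).mp himy
    refine ⟨c * m, fun h => ?_, ?_⟩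
    · rcases ‹M.IsPrime›.mem_or_mem h with h | h
      · exact hc h
      · exact hm h
    · have : c * m * y = c * (y * m) := by ring
      rw [this, hcc]
      exact I.mul_mem_left _ hi
  · rintro ⟨t, ht, hty⟩
    have hu : IsUnit (algebraMap A B t) := IsLocalization.map_units B (⟨t, ht⟩ : M.primeCompl)
    have : algebraMap A B y = (hu.unit⁻¹ : Bˣ) * algebraMap A B (t * y) := by
      rw [map_mul, ← mul_assoc, IsUnit.val_inv_mul, one_mul]
    rw [this]
    exact Ideal.mul_mem_left _ _ (Ideal.mem_map_of_mem _ hty)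

/-! ## Finite type algebras over an algebraically closed field -/

section AlgClosed

variable (K : Type u) [Field K] {A : Type v} [CommRing A] [Algebra K A]

/-- **Nullstellensatz**: at a maximal ideal `M` of a finite type algebra `A` over an
algebraically closed field `K`, every `a ∈ A` is congruent to a scalar: `A/M = K` (Zariski's
lemma, Mathlib `finite_of_finite_type_of_isJacobsonRing`, and `K = K̄`). [folklore] -/
theorem exists_sub_algebraMap_mem_of_isMaximal [IsAlgClosed K] [Algebra.FiniteType K A]
    (M : Ideal A) [M.IsMaximal] (a : A) : ∃ c : K, a - algebraMap K A c ∈ M := by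
  letI : Field (A ⧸ M) := Ideal.Quotient.field M
  haveI : Module.Finite K (A ⧸ M) := finite_of_finite_type_of_isJacobsonRing K (A ⧸ M)
  haveI : Algebra.IsIntegral K (A ⧸ M) := Algebra.IsIntegral.of_finite K (A ⧸ M)
  obtain ⟨c, hc⟩ := (IsAlgClosed.algebraMap_bijective_of_isIntegral (k := K) (K := A ⧸ M)).2
    (Ideal.Quotient.mk M a)
  refine ⟨c, ?_⟩
  rw [← Ideal.Quotient.eq_zero_iff_mem, map_sub, ← hc, ← Ideal.Quotient.algebraMap_eq,
    ← IsScalarTower.algebraMap_apply, sub_self]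

/-- The same, read in the local ring `A_M`: every element of `A_M` is a scalar plus an element
of the maximal ideal (the residue field of `A_M` is `K`). [folklore] -/
theorem exists_sub_algebraMap_mem_maximalIdeal_of_isMaximal [IsAlgClosed K]
    [Algebra.FiniteType K A] (M : Ideal A) [hM : M.IsMaximal] {B : Type w} [CommRing B]
    [Algebra A B] [Algebra K B] [IsScalarTower K A B] [IsLocalization.AtPrime B M] [IsLocalRing B]
    (b : B) : ∃ c : K, b - algebraMap K B c ∈ maximalIdeal B := by
  obtain ⟨a, s, rfl⟩ := IsLocalization.exists_mk'_eq M.primeCompl b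
  -- `s` is invertible modulo the maximal ideal `M`
  obtain ⟨s', i, hi, hss'⟩ := hM.exists_inv s.2
  obtain ⟨c, hc⟩ := exists_sub_algebraMap_mem_of_isMaximal K M (s' * a)
  refine ⟨c, ?_⟩
  have key : a - (s : A) * algebraMap K A c = i * a + (s : A) * (s' * a - algebraMap K A c) := by
    have h1 : a = (s' * (s : A) + i) * a := by rw [hss', one_mul]
    linear_combination h1
  -- multiply by the unit `s/1`
  have hunit : IsUnit (algebraMap A B s) := IsLocalization.map_units B s
  rw [← Ideal.unit_mul_mem_iff_mem _ hunit, mul_sub, IsLocalization.mk'_spec',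
    IsScalarTower.algebraMap_apply K A B c, ← map_mul, ← map_sub, key, map_add, map_mul _ (s : A)]
  refine Ideal.add_mem _ ?_ (Ideal.mul_mem_left _ _ ?_)
  · exact (IsLocalization.AtPrime.to_map_mem_maximal_iff B M _).mpr (M.mul_mem_right _ hi)
  · exact (IsLocalization.AtPrime.to_map_mem_maximal_iff B M _).mpr hc

variable [IsAlgClosed K] [Algebra.FiniteType K A]

/-- **`M A_M ⊆ Fitt₁(Ω_{A/K}) A_M` at a nodal-or-regular closed point** of a finite type scheme
over `K = K̄` (Stacks 0C4D (1) ⇒ (4) at a node, via `NodeFittingIdeal.lean`; at a nonsingular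
point of a curve `Ω` is free of rank `1` and `Fitt₁ = (1)`), in the form: every `y ∈ M` is
multiplied into `Fitt₁(Ω_{A/K})` by some `t ∉ M`. The hypothesis is the fibre condition of a
semi-stable curve (de Jong 1996, 2.21) at the maximal ideal `M`: `A_M` is regular of dimension
`1`, or its completion is `K⟦u, v⟧/(uv)`. [cite: StacksProject, Tag 0C4D] -/
theorem exists_mul_mem_fittingIdeal_of_isMaximal (M : Ideal A) [hM : M.IsMaximal]
    (hnode : (IsRegularLocalRing (Localization.AtPrime M) ∧
        ringKrullDim (Localization.AtPrime M) = 1) ∨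
      Nonempty (AdicCompletion (maximalIdeal (Localization.AtPrime M)) (Localization.AtPrime M) ≃+*
        MvPowerSeries (Fin 2) K ⧸
          Ideal.span {(MvPowerSeries.X 0 * MvPowerSeries.X 1 : MvPowerSeries (Fin 2) K)}))
    {y : A} (hy : y ∈ M) : ∃ t ∉ M, t * y ∈ Module.fittingIdeal A (Ω[A⁄K]) 1 := by
  haveI : IsNoetherianRing A := Algebra.FiniteType.isNoetherianRing K A
  haveI : IsNoetherianRing (Localization.AtPrime M) :=
    IsLocalization.isNoetherianRing M.primeCompl _ inferInstance
  haveI : Algebra.EssFiniteType K (Localization.AtPrime M) :=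
    Algebra.EssFiniteType.comp K A (Localization.AtPrime M)
  have hK : ∀ b : Localization.AtPrime M, ∃ c : K,
      b - algebraMap K (Localization.AtPrime M) c ∈ maximalIdeal (Localization.AtPrime M) :=
    exists_sub_algebraMap_mem_maximalIdeal_of_isMaximal K M
  have hFitt : Module.fittingIdeal (Localization.AtPrime M) (Ω[Localization.AtPrime M⁄K]) 1 =
      (Module.fittingIdeal A (Ω[A⁄K]) 1).map (algebraMap A (Localization.AtPrime M)) :=
    Module.fittingIdeal_kaehlerDifferential_of_isLocalization' M.primeCompl 1
  have hle : maximalIdeal (Localization.AtPrime M) ≤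
      Module.fittingIdeal (Localization.AtPrime M) (Ω[Localization.AtPrime M⁄K]) 1 := by
    rcases hnode with ⟨hreg, hdim⟩ | ⟨⟨e⟩⟩
    · -- a nonsingular point of a curve: `𝔪` is principal, `Ω` is cyclic, `Fitt₁ = (1)`
      have hrank : (maximalIdeal (Localization.AtPrime M)).spanFinrank = 1 := by
        have h := hreg.spanFinrank_maximalIdeal
        rw [hdim] at h
        exact_mod_cast h
      obtain ⟨s, hs, hspan⟩ := Submodule.FG.exists_span_finset_card_eq_spanFinrank
        (IsNoetherian.noetherian (maximalIdeal (Localization.AtPrime M)))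
      rw [hrank] at hs
      obtain ⟨t, rfl⟩ := Finset.card_eq_one.mp hs
      have hmt : maximalIdeal (Localization.AtPrime M) = Ideal.span (Set.range ![t]) := by
        rw [← hspan, Finset.coe_singleton, Matrix.range_cons, Matrix.range_empty,
          Set.union_empty]
      rw [Module.fittingIdeal_kaehler_eq_top_of_maximalIdeal_eq_span hK ![t] hmt]
      exact le_top
    · exact maximalIdeal_le_fittingIdeal_kaehler_of_ringEquiv_adicCompletion hK e
  have hmem : algebraMap A (Localization.AtPrime M) y ∈
      (Module.fittingIdeal A (Ω[A⁄K]) 1).map (algebraMap A (Localization.AtPrime M)) := by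
    rw [← hFitt]
    exact hle ((IsLocalization.AtPrime.to_map_mem_maximal_iff (Localization.AtPrime M) M y).mpr hy)
  exact (IsLocalization.AtPrime.algebraMap_mem_map_iff M _ y).mp hmem

/-- **The singular scheme of a nodal curve over `K = K̄` is zero-dimensional**: if every maximal
ideal of the finite type `K`-algebra `A` is nodal-or-regular, then every prime ideal containing
`Fitt₁(Ω_{A/K})` is maximal (a prime `Q ⊊ M` containing `Fitt₁` would contain `t y` with
`t, y ∉ Q`). [cite: StacksProject, Tag 0C4D] -/
theorem isMaximal_of_fittingIdeal_le
    (hA : ∀ (M : Ideal A) [M.IsMaximal],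
      (IsRegularLocalRing (Localization.AtPrime M) ∧ ringKrullDim (Localization.AtPrime M) = 1) ∨
      Nonempty (AdicCompletion (maximalIdeal (Localization.AtPrime M)) (Localization.AtPrime M) ≃+*
        MvPowerSeries (Fin 2) K ⧸
          Ideal.span {(MvPowerSeries.X 0 * MvPowerSeries.X 1 : MvPowerSeries (Fin 2) K)}))
    (Q : Ideal A) [hQ : Q.IsPrime] (hJQ : Module.fittingIdeal A (Ω[A⁄K]) 1 ≤ Q) : Q.IsMaximal := by
  obtain ⟨M, hM, hQM⟩ := Q.exists_le_maximal hQ.ne_top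
  suffices h : Q = M by rw [h]; exact hM
  refine le_antisymm hQM fun y hy => ?_
  obtain ⟨t, ht, hty⟩ := exists_mul_mem_fittingIdeal_of_isMaximal K M (hA M) hy
  rcases hQ.mem_or_mem (hJQ hty) with h | h
  · exact absurd (hQM h) ht
  · exact h

/-- **The singular scheme of the geometric fibre is a union of reduced `K`-points**: with `A`
as above, for any `K`-algebra surjection `π : A → D'` killing `Fitt₁(Ω_{A/K})` (e.g.
`D' = A/Fitt₁`, or a base change of `T/Fitt₁(Ω_{T/R})`) and any prime `Q` of `D'`, the structure
map `K → D'_Q` is surjective: `D'_Q` is the field `K`. Indeed `Q` pulls back to a MAXIMAL ideal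
`Q_A ⊇ Fitt₁` of `A`, every element of `A` is a scalar modulo `Q_A` (Nullstellensatz), and
`Q_A A_{Q_A} ⊆ Fitt₁ A_{Q_A}` dies in `D'_Q`. [cite: StacksProject, Tag 0C4D] -/
theorem algebraMap_surjective_of_fittingIdeal_le_ker
    (hA : ∀ (M : Ideal A) [M.IsMaximal],
      (IsRegularLocalRing (Localization.AtPrime M) ∧ ringKrullDim (Localization.AtPrime M) = 1) ∨
      Nonempty (AdicCompletion (maximalIdeal (Localization.AtPrime M)) (Localization.AtPrime M) ≃+*
        MvPowerSeries (Fin 2) K ⧸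
          Ideal.span {(MvPowerSeries.X 0 * MvPowerSeries.X 1 : MvPowerSeries (Fin 2) K)}))
    {D' : Type w} [CommRing D'] [Algebra K D'] (π : A →ₐ[K] D') (hπ : Function.Surjective π)
    (hker : Module.fittingIdeal A (Ω[A⁄K]) 1 ≤ RingHom.ker π) (Q : Ideal D') [hQ : Q.IsPrime]
    (F : Type*) [CommRing F] [Algebra D' F] [Algebra K F] [IsScalarTower K D' F]
    [IsLocalization.AtPrime F Q] : Function.Surjective (algebraMap K F) := by
  haveI := IsLocalization.AtPrime.isLocalRing F Q
  -- `Q` pulls back to a maximal ideal of `A` containing `Fitt₁`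
  set QA : Ideal A := Q.comap π.toRingHom with hQA
  haveI : QA.IsPrime := Ideal.IsPrime.comap _
  have hJQA : Module.fittingIdeal A (Ω[A⁄K]) 1 ≤ QA :=
    hker.trans fun a ha => by
      change π a ∈ Q
      rw [RingHom.mem_ker] at ha
      change π a = 0 at ha
      rw [ha]
      exact Q.zero_mem
  haveI : QA.IsMaximal := isMaximal_of_fittingIdeal_le K hA QA hJQA
  -- every element of `D'` is a scalar in `F = D'_Q`
  have key : ∀ d : D', ∃ c : K, algebraMap D' F d = algebraMap K F c ∧ (d ∉ Q → c ≠ 0) := by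
    intro d
    obtain ⟨a, rfl⟩ := hπ d
    obtain ⟨c, hc⟩ := exists_sub_algebraMap_mem_of_isMaximal K QA a
    obtain ⟨t, ht, htac⟩ := exists_mul_mem_fittingIdeal_of_isMaximal K QA (hA QA) hc
    refine ⟨c, ?_, fun ha h0 => ?_⟩
    · -- `π(t) (π a - c) = 0` with `π t ∉ Q`, a unit in `F`
      have h0 : π t * (π a - algebraMap K D' c) = 0 := by
        have := hker htac
        rw [RingHom.mem_ker] at this
        change π (t * (a - algebraMap K A c)) = 0 at this
        rwa [map_mul, map_sub, AlgHom.commutes] at this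
      have hu : IsUnit (algebraMap D' F (π t)) :=
        IsLocalization.map_units F (⟨π t, ht⟩ : Q.primeCompl)
      have h1 : algebraMap D' F (π t) * (algebraMap D' F (π a) - algebraMap K F c) = 0 := by
        rw [IsScalarTower.algebraMap_apply K D' F, ← map_sub, ← map_mul, h0, map_zero]
      exact sub_eq_zero.mp ((hu.mul_right_eq_zero).mp h1)
    · -- if `c = 0` then `a ∈ QA`, i.e. `π a ∈ Q`
      apply ha
      rw [h0, map_zero, sub_zero] at hc
      exact hc
  intro z
  obtain ⟨d, s, rfl⟩ := IsLocalization.exists_mk'_eq Q.primeCompl z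
  obtain ⟨cd, hcd, -⟩ := key d
  obtain ⟨cs, hcs, hcs0⟩ := key s
  have hcs0 : cs ≠ 0 := hcs0 s.2
  refine ⟨cd * cs⁻¹, ?_⟩
  rw [IsLocalization.eq_mk'_iff_mul_eq, hcd, hcs, ← map_mul, mul_assoc, inv_mul_cancel₀ hcs0,
    mul_one]

end AlgClosed

/-! ## Unramifiedness descends from a geometric point -/

section Descent

variable {R : Type*} {D : Type*} {K : Type*} {DK : Type*} {F : Type*}
  [CommRing R] [CommRing D] [CommRing K] [CommRing DK] [CommRing F]
  [Algebra R D] [Algebra R K] [Algebra K DK] [Algebra D DK] [Algebra R DK]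
  [IsScalarTower R K DK] [IsScalarTower R D DK]

/-- **Unramifiedness at a prime descends from any point of a base change over it.** Let `D` be
an `R`-algebra essentially of finite type, `R → K` any ring map, `D_K = K ⊗_R D` (a pushout
square), `Q` a prime of `D_K` over the prime `𝔮` of `D`, and `F = (D_K)_Q`. If `F` is formally
unramified over `K` (`Ω_{F/K} = 0`), then `D` is unramified over `R` at `𝔮`. Proof:
`F ⊗_D Ω_{D/R} = F ⊗_{D_K} Ω_{D_K/K} = Ω_{F/K} = 0` (differentials commute with base change and
localisation), hence `k_F ⊗_D Ω_{D/R} = 0` for the residue field `k_F` of `F`, a field extension of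
`κ(𝔮)` (`D_𝔮 → F` is local), hence `κ(𝔮) ⊗ Ω_{D_𝔮/R} = 0` (a field extension is faithfully
flat) and `Ω_{D_𝔮/R} = 0` by Nakayama. No flatness of `R → K` is used. (The converse direction,
unramified ⟹ unramified after base change, is Mathlib's `Algebra.FormallyUnramified.baseChange`.)
[cite: StacksProject, Tag 02FM] -/
theorem Algebra.isUnramifiedAt_of_formallyUnramified_localization
    [Algebra.IsPushout R K D DK] [Algebra.EssFiniteType R D]
    (Q : Ideal DK) [Q.IsPrime] [Algebra DK F] [Algebra K F] [IsScalarTower K DK F]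
    [IsLocalization.AtPrime F Q] [Algebra.FormallyUnramified K F]
    (q : Ideal D) [q.IsPrime] (hq : q = Q.comap (algebraMap D DK)) :
    Algebra.IsUnramifiedAt R q := by
  subst hq
  set q : Ideal D := Q.comap (algebraMap D DK) with hq
  haveI : IsLocalRing F := IsLocalization.AtPrime.isLocalRing F Q
  -- the local homomorphism `D_𝔮 → F`
  let g : D →+* F := (algebraMap DK F).comp (algebraMap D DK)
  have hg : ∀ s : q.primeCompl, IsUnit (g s) := fun s =>
    IsLocalization.map_units F (⟨algebraMap D DK s, s.2⟩ : Q.primeCompl)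
  letI : Algebra D F := g.toAlgebra
  haveI : IsScalarTower D DK F := IsScalarTower.of_algebraMap_eq fun _ => rfl
  letI : Algebra (Localization.AtPrime q) F := (IsLocalization.lift (M := q.primeCompl) hg).toAlgebra
  haveI : IsScalarTower D (Localization.AtPrime q) F :=
    IsScalarTower.of_algebraMap_eq fun x => (IsLocalization.lift_eq hg x).symm
  haveI : IsLocalHom (algebraMap (Localization.AtPrime q) F) := by
    constructor
    intro x hx
    obtain ⟨d, s, rfl⟩ := IsLocalization.exists_mk'_eq q.primeCompl x
    rw [IsLocalization.AtPrime.isUnit_mk'_iff]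
    intro hd
    -- `g d ∈ 𝔪_F`, but `g d = g s · (unit)`
    have h1 : g d = g s * algebraMap (Localization.AtPrime q) F (IsLocalization.mk' _ d s) :=
      (IsLocalization.lift_mk'_spec hg d _ s).mp rfl
    have hdm : g d ∈ maximalIdeal F :=
      (IsLocalization.AtPrime.to_map_mem_maximal_iff F Q (algebraMap D DK d)).mpr hd
    exact hdm (h1 ▸ (hg s).mul hx)
  -- residue fields: `κ(𝔮) → k_F` is Mathlib's `Algebra (ResidueField _) (ResidueField F)`
  haveI : IsScalarTower D F F := IsScalarTower.right
  -- Step 1: `F ⊗_D Ω_{D/R} ≅ Ω_{F/K} = 0`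
  have h1 : Subsingleton (F ⊗[D] Ω[D⁄R]) := by
    let e1 : F ⊗[D] Ω[D⁄R] ≃ₗ[F] F ⊗[DK] (DK ⊗[D] Ω[D⁄R]) :=
      (AlgebraTensorModule.cancelBaseChange D DK F F (Ω[D⁄R])).symm
    let e2 : F ⊗[DK] (DK ⊗[D] Ω[D⁄R]) ≃ₗ[F] F ⊗[DK] Ω[DK⁄K] :=
      AlgebraTensorModule.congr (LinearEquiv.refl F F) (KaehlerDifferential.tensorKaehlerEquiv R K D DK)
    let e3 : F ⊗[DK] Ω[DK⁄K] ≃ₗ[F] Ω[F⁄K] :=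
      (IsLocalizedModule.isBaseChange Q.primeCompl F (KaehlerDifferential.map K K DK F)).equiv
    exact (e1.trans (e2.trans e3)).toEquiv.subsingleton
  -- Step 2: `k_F ⊗_{D_𝔮} Ω_{D_𝔮/R} = 0`
  have h2 : Subsingleton (ResidueField F ⊗[Localization.AtPrime q] Ω[Localization.AtPrime q⁄R]) := by
    let eq1 : Localization.AtPrime q ⊗[D] Ω[D⁄R] ≃ₗ[Localization.AtPrime q]
        Ω[Localization.AtPrime q⁄R] :=
      (IsLocalizedModule.isBaseChange q.primeCompl (Localization.AtPrime q)
        (KaehlerDifferential.map R R D (Localization.AtPrime q))).equiv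
    let e : ResidueField F ⊗[Localization.AtPrime q] Ω[Localization.AtPrime q⁄R] ≃ₗ[ResidueField F]
        ResidueField F ⊗[D] Ω[D⁄R] :=
      (AlgebraTensorModule.congr (LinearEquiv.refl (ResidueField F) (ResidueField F)) eq1.symm).trans
        (AlgebraTensorModule.cancelBaseChange D (Localization.AtPrime q) (ResidueField F)
          (ResidueField F) (Ω[D⁄R]))
    -- `k_F ⊗_D Ω` is a quotient of `F ⊗_D Ω`
    have hsurj : Function.Surjective
        (LinearMap.rTensor (Ω[D⁄R]) ((IsScalarTower.toAlgHom D F (ResidueField F)).toLinearMap)) :=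
      LinearMap.rTensor_surjective _ (by exact residue_surjective)
    haveI := h1
    haveI : Subsingleton (ResidueField F ⊗[D] Ω[D⁄R]) := hsurj.subsingleton
    exact e.toEquiv.subsingleton
  -- Step 3: faithfully flat descent along `κ(𝔮) → k_F`, then Nakayama over `D_𝔮`
  have h3 : Subsingleton (ResidueField (Localization.AtPrime q) ⊗[Localization.AtPrime q]
      Ω[Localization.AtPrime q⁄R]) := by
    let e := AlgebraTensorModule.cancelBaseChange (Localization.AtPrime q)
      (ResidueField (Localization.AtPrime q)) (ResidueField F) (ResidueField F)
      (Ω[Localization.AtPrime q⁄R])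
    haveI := h2
    haveI : Subsingleton (ResidueField F ⊗[ResidueField (Localization.AtPrime q)]
        (ResidueField (Localization.AtPrime q) ⊗[Localization.AtPrime q]
          Ω[Localization.AtPrime q⁄R])) := e.toEquiv.subsingleton
    exact (Module.FaithfullyFlat.subsingleton_tensorProduct_iff_right
      (ResidueField (Localization.AtPrime q)) (ResidueField F)).mp this
  have h4 : Subsingleton (Ω[Localization.AtPrime q⁄R]) :=
    (IsLocalRing.subsingleton_tensorProduct (R := Localization.AtPrime q)).mp h3
  exact ⟨h4⟩

end Descent

/-! ## A point of the geometric fibre over a given point of the fibre -/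

section GeometricPoint

variable {R : Type*} {T : Type*} [CommRing R] [CommRing T] [Algebra R T]
  (p : Ideal R) [p.IsPrime] (q : Ideal T) [q.IsPrime] (K : Type*) [Field K] [Algebra R K]

/-- **Every point of a fibre lifts to the geometric fibre**: for a prime `𝔮` of `T` over `𝔭` and a
field `K ⊇ κ(𝔭)`, there is a prime of `K ⊗_R T` contracting to `𝔮` — the kernel of
`K ⊗_R T → L` for a common field extension `L` of `K` and `κ(𝔮)` over `κ(𝔭)` (a quotient of the
non-zero ring `K ⊗_{κ(𝔭)} κ(𝔮)`). [folklore] -/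
theorem exists_isPrime_comap_includeRight_eq [q.LiesOver p] [Algebra p.ResidueField K]
    [IsScalarTower R p.ResidueField K] :
    ∃ Q : Ideal (K ⊗[R] T), Q.IsPrime ∧
      Q.comap (Algebra.TensorProduct.includeRight (R := R) (A := K) (B := T)).toRingHom = q := by
  letI := Localization.AtPrime.algebraOfLiesOver p q
  -- a common field extension `L` of `K` and `κ(q)` over `κ(p)`
  obtain ⟨m, hm⟩ := Ideal.exists_maximal (K ⊗[p.ResidueField] q.ResidueField)
  letI : Field ((K ⊗[p.ResidueField] q.ResidueField) ⧸ m) := Ideal.Quotient.field m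
  -- the `R`-algebra maps `K → L` and `T → L`
  let iK : K →ₐ[R] (K ⊗[p.ResidueField] q.ResidueField) ⧸ m :=
    ((Ideal.Quotient.mkₐ p.ResidueField m).comp Algebra.TensorProduct.includeLeft).restrictScalars R
  let iT : T →ₐ[R] (K ⊗[p.ResidueField] q.ResidueField) ⧸ m :=
    (((Ideal.Quotient.mkₐ p.ResidueField m).comp
      Algebra.TensorProduct.includeRight).restrictScalars R).comp
      (IsScalarTower.toAlgHom R T q.ResidueField)
  let Φ : K ⊗[R] T →ₐ[R] (K ⊗[p.ResidueField] q.ResidueField) ⧸ m :=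
    Algebra.TensorProduct.lift iK iT fun _ _ => Commute.all _ _
  refine ⟨RingHom.ker Φ.toRingHom, RingHom.ker_isPrime _, ?_⟩
  ext x
  rw [Ideal.mem_comap, RingHom.mem_ker]
  change Φ (1 ⊗ₜ x) = 0 ↔ x ∈ q
  rw [Algebra.TensorProduct.lift_tmul, map_one, one_mul]
  change Ideal.Quotient.mk m ((1 : K) ⊗ₜ algebraMap T q.ResidueField x) = 0 ↔ x ∈ q
  rw [← Ideal.algebraMap_residueField_eq_zero (I := q), ← Algebra.TensorProduct.includeRight_apply]
  constructor
  · intro h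
    -- `κ(q) → L` is injective (a field into a non-zero ring)
    have hinj : Function.Injective ((Ideal.Quotient.mk m).comp
        (Algebra.TensorProduct.includeRight (R := p.ResidueField) (A := K)
          (B := q.ResidueField)).toRingHom) := RingHom.injective _
    exact hinj (by simpa using h)
  · intro h
    rw [h, map_zero, map_zero]

end GeometricPoint

/-! ## The ring-level statement: `T/Fitt₁(Ω_{T/R})` is unramified over `R` -/

section Main

variable {R T : Type u} [CommRing R] [CommRing T] [Algebra R T] [Algebra.FiniteType R T]
  (K : Type u) [Field K] [IsAlgClosed K] [Algebra R K]
  (p : Ideal R) [p.IsPrime] (q : Ideal T) [q.IsPrime]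

omit [q.IsPrime] in
/-- **`Sing(f) → S` is unramified (de Jong 1996, 2.21; Stacks 0C59), at rings.** Let `T` be a
finite type `R`-algebra, `J = Fitt₁(Ω_{T/R})` (the ideal of the singular scheme), `𝔮 ⊇ J` a
prime of `T` over `𝔭`, and `K ⊇ κ(𝔭)` an algebraically closed field such that every maximal
ideal of the geometric fibre ring `K ⊗_R T` is a nonsingular point of a curve or an ordinary
double point (the fibre condition of a semi-stable curve). Then `T/J` is unramified over `R` at
`𝔮/J`: choose a prime `Q` of `K ⊗_R (T/J)` over `𝔮/J` (`exists_isPrime_comap_includeRight_eq`);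
`K → (K ⊗_R (T/J))_Q` is onto (`algebraMap_surjective_of_fittingIdeal_le_ker`, the formation of
`Fitt₁` commuting with base change), so this local ring is formally unramified over `K`, and
unramifiedness descends (`Algebra.isUnramifiedAt_of_formallyUnramified_localization`).
[cite: DeJong1996, 2.21, p. 61] -/
theorem isUnramifiedAt_map_mk_fittingIdeal [q.LiesOver p] [Algebra p.ResidueField K]
    [IsScalarTower R p.ResidueField K]
    (hA : ∀ (M : Ideal (K ⊗[R] T)) [M.IsMaximal],
      (IsRegularLocalRing (Localization.AtPrime M) ∧ ringKrullDim (Localization.AtPrime M) = 1) ∨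
      Nonempty (AdicCompletion (maximalIdeal (Localization.AtPrime M)) (Localization.AtPrime M) ≃+*
        MvPowerSeries (Fin 2) K ⧸
          Ideal.span {(MvPowerSeries.X 0 * MvPowerSeries.X 1 : MvPowerSeries (Fin 2) K)}))
    (hJq : Module.fittingIdeal T (Ω[T⁄R]) 1 ≤ q)
    [hqJ : (q.map (Ideal.Quotient.mk (Module.fittingIdeal T (Ω[T⁄R]) 1))).IsPrime] :
    Algebra.IsUnramifiedAt R (q.map (Ideal.Quotient.mk (Module.fittingIdeal T (Ω[T⁄R]) 1))) := by
  set J : Ideal T := Module.fittingIdeal T (Ω[T⁄R]) 1 with hJ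
  set qD : Ideal (T ⧸ J) := q.map (Ideal.Quotient.mk J) with hqD
  -- the `T`-algebra structures on the base changes (Mathlib's `rightAlgebra`, not an instance)
  letI : Algebra T (K ⊗[R] T) := Algebra.TensorProduct.rightAlgebra
  letI : Algebra (T ⧸ J) (K ⊗[R] (T ⧸ J)) := Algebra.TensorProduct.rightAlgebra
  -- `q/J` lies over `p`
  have hcomap : qD.comap (Ideal.Quotient.mk J) = q := by
    rw [hqD, Ideal.comap_map_of_surjective _ Ideal.Quotient.mk_surjective, ← RingHom.ker_eq_comap_bot,
      Ideal.mk_ker, sup_eq_left.mpr hJq]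
  haveI : qD.LiesOver p := ⟨by
    rw [Ideal.under_def, IsScalarTower.algebraMap_eq R T (T ⧸ J), ← Ideal.comap_comap,
      Ideal.Quotient.algebraMap_eq, hcomap]
    exact Ideal.LiesOver.over⟩
  -- a prime `Q` of `K ⊗ (T/J)` over `q/J`
  obtain ⟨Q, hQ, hQq⟩ := exists_isPrime_comap_includeRight_eq p qD K
  haveI := hQ
  -- the surjection `π : K ⊗ T → K ⊗ (T/J)` kills `Fitt₁(Ω_{K ⊗ T / K}) = J · (K ⊗ T)`
  let π : K ⊗[R] T →ₐ[K] K ⊗[R] (T ⧸ J) :=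
    Algebra.TensorProduct.map (AlgHom.id K K) (Ideal.Quotient.mkₐ R J)
  have hπ : Function.Surjective π := by
    intro z
    induction z using TensorProduct.induction_on with
    | zero => exact ⟨0, map_zero π⟩
    | tmul a b =>
      obtain ⟨t, rfl⟩ := Ideal.Quotient.mk_surjective b
      exact ⟨a ⊗ₜ t, by rw [Algebra.TensorProduct.map_tmul]; rfl⟩
    | add x y hx hy =>
      obtain ⟨x, rfl⟩ := hx
      obtain ⟨y, rfl⟩ := hy
      exact ⟨x + y, map_add π x y⟩
  have hker : Module.fittingIdeal (K ⊗[R] T) (Ω[K ⊗[R] T⁄K]) 1 ≤ RingHom.ker π := by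
    rw [Module.fittingIdeal_kaehlerDifferential_of_isPushout R K T (K ⊗[R] T) 1, Ideal.map_le_iff_le_comap]
    intro j hj
    rw [Ideal.mem_comap, RingHom.mem_ker, Algebra.TensorProduct.right_algebraMap_apply]
    change π (1 ⊗ₜ j) = 0
    rw [Algebra.TensorProduct.map_tmul, AlgHom.id_apply, Ideal.Quotient.mkₐ_eq_mk,
      Ideal.Quotient.eq_zero_iff_mem.mpr hj, TensorProduct.tmul_zero]
  -- `K → (K ⊗ (T/J))_Q` is onto, hence formally unramified
  have hsurj : Function.Surjective (algebraMap K (Localization.AtPrime Q)) :=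
    algebraMap_surjective_of_fittingIdeal_le_ker K hA π hπ hker Q (Localization.AtPrime Q)
  haveI : Algebra.FormallyUnramified K (Localization.AtPrime Q) :=
    Algebra.FormallyUnramified.of_surjective (Algebra.ofId K (Localization.AtPrime Q)) hsurj
  -- descent
  exact Algebra.isUnramifiedAt_of_formallyUnramified_localization (R := R) (D := T ⧸ J)
    (K := K) (DK := K ⊗[R] (T ⧸ J)) Q (F := Localization.AtPrime Q) qD hQq.symm

/-- **Consequence (a): `𝔮 T_𝔮 ⊆ J T_𝔮 + 𝔭 T_𝔮`** (Stacks 00UW (1): for `T/J` unramified over `R`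
at `𝔮/J`, `𝔭 (T/J)_𝔮 = (𝔮/J)(T/J)_𝔮`), in `T`: every `y ∈ 𝔮` is multiplied into
`Fitt₁(Ω_{T/R}) + 𝔭 T` by some `s ∉ 𝔮`. [cite: DeJong1996, 2.21, p. 61] -/
theorem exists_mul_mem_fittingIdeal_sup_of_geometricFibre [q.LiesOver p] [Algebra p.ResidueField K]
    [IsScalarTower R p.ResidueField K]
    (hA : ∀ (M : Ideal (K ⊗[R] T)) [M.IsMaximal],
      (IsRegularLocalRing (Localization.AtPrime M) ∧ ringKrullDim (Localization.AtPrime M) = 1) ∨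
      Nonempty (AdicCompletion (maximalIdeal (Localization.AtPrime M)) (Localization.AtPrime M) ≃+*
        MvPowerSeries (Fin 2) K ⧸
          Ideal.span {(MvPowerSeries.X 0 * MvPowerSeries.X 1 : MvPowerSeries (Fin 2) K)}))
    (hJq : Module.fittingIdeal T (Ω[T⁄R]) 1 ≤ q) {y : T} (hy : y ∈ q) :
    ∃ s ∉ q, s * y ∈ Module.fittingIdeal T (Ω[T⁄R]) 1 ⊔ p.map (algebraMap R T) := by
  set J : Ideal T := Module.fittingIdeal T (Ω[T⁄R]) 1 with hJ
  set qD : Ideal (T ⧸ J) := q.map (Ideal.Quotient.mk J) with hqD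
  have hcomap : qD.comap (Ideal.Quotient.mk J) = q := by
    rw [hqD, Ideal.comap_map_of_surjective _ Ideal.Quotient.mk_surjective, ← RingHom.ker_eq_comap_bot,
      Ideal.mk_ker, sup_eq_left.mpr hJq]
  haveI hqJ : qD.IsPrime :=
    Ideal.map_isPrime_of_surjective Ideal.Quotient.mk_surjective (by rw [Ideal.mk_ker]; exact hJq)
  haveI : qD.LiesOver p := ⟨by
    rw [Ideal.under_def, IsScalarTower.algebraMap_eq R T (T ⧸ J), ← Ideal.comap_comap,
      Ideal.Quotient.algebraMap_eq, hcomap]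
    exact Ideal.LiesOver.over⟩
  letI := Localization.AtPrime.algebraOfLiesOver p qD
  haveI : Algebra.IsUnramifiedAt R qD := isUnramifiedAt_map_mk_fittingIdeal K p q hA hJq
  have hmap : p.map (algebraMap R (Localization.AtPrime qD)) = maximalIdeal _ :=
    ((Algebra.isUnramifiedAt_iff_map_eq R p qD).mp inferInstance).2
  -- `mk y / 1 ∈ 𝔭 (T/J)_{q/J}`
  have hy' : algebraMap (T ⧸ J) (Localization.AtPrime qD) (Ideal.Quotient.mk J y) ∈
      (p.map (algebraMap R (T ⧸ J))).map (algebraMap (T ⧸ J) (Localization.AtPrime qD)) := by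
    rw [Ideal.map_map, ← IsScalarTower.algebraMap_eq, hmap]
    exact (IsLocalization.AtPrime.to_map_mem_maximal_iff (Localization.AtPrime qD) qD _).mpr
      (Ideal.mem_map_of_mem _ hy)
  obtain ⟨t, ht, hty⟩ := (IsLocalization.AtPrime.algebraMap_mem_map_iff qD _ _).mp hy'
  obtain ⟨s, rfl⟩ := Ideal.Quotient.mk_surjective t
  refine ⟨s, fun hs => ht (Ideal.mem_map_of_mem _ hs), ?_⟩
  rw [← map_mul, IsScalarTower.algebraMap_eq R T (T ⧸ J), ← Ideal.map_map,
    Ideal.Quotient.algebraMap_eq, Ideal.mem_map_iff_of_surjective _ Ideal.Quotient.mk_surjective] at hty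
  obtain ⟨z, hz, hzy⟩ := hty
  rw [Ideal.Quotient.eq] at hzy
  have : s * y = z - (z - s * y) := by ring
  rw [this, sup_comm]
  exact Ideal.sub_mem _ (Ideal.mem_sup_left hz) (Ideal.mem_sup_right hzy)

/-- **Consequence (b): `κ(𝔮)/κ(𝔭)` is separable** (Stacks 00UW (2); de Jong 1996, 2.23: "The
extension `κ(s) ⊂ κ(x)` is finite separable, as `Sing(f) → S` is finite unramified"), for the
canonical embedding `κ(𝔭) → κ(𝔮)` (Mathlib `Ideal.ResidueField.map`).
[cite: DeJong1996, 2.21–2.23, p. 61] -/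
theorem isSeparable_residueField_of_geometricFibre [q.LiesOver p] [Algebra p.ResidueField K]
    [IsScalarTower R p.ResidueField K]
    (hA : ∀ (M : Ideal (K ⊗[R] T)) [M.IsMaximal],
      (IsRegularLocalRing (Localization.AtPrime M) ∧ ringKrullDim (Localization.AtPrime M) = 1) ∨
      Nonempty (AdicCompletion (maximalIdeal (Localization.AtPrime M)) (Localization.AtPrime M) ≃+*
        MvPowerSeries (Fin 2) K ⧸
          Ideal.span {(MvPowerSeries.X 0 * MvPowerSeries.X 1 : MvPowerSeries (Fin 2) K)}))
    (hJq : Module.fittingIdeal T (Ω[T⁄R]) 1 ≤ q) :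
    letI := Localization.AtPrime.algebraOfLiesOver p q
    Algebra.IsSeparable p.ResidueField q.ResidueField := by
  letI := Localization.AtPrime.algebraOfLiesOver p q
  set J : Ideal T := Module.fittingIdeal T (Ω[T⁄R]) 1 with hJ
  set qD : Ideal (T ⧸ J) := q.map (Ideal.Quotient.mk J) with hqD
  have hcomap : qD.comap (Ideal.Quotient.mk J) = q := by
    rw [hqD, Ideal.comap_map_of_surjective _ Ideal.Quotient.mk_surjective, ← RingHom.ker_eq_comap_bot,
      Ideal.mk_ker, sup_eq_left.mpr hJq]
  haveI hqJ : qD.IsPrime :=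
    Ideal.map_isPrime_of_surjective Ideal.Quotient.mk_surjective (by rw [Ideal.mk_ker]; exact hJq)
  haveI : qD.LiesOver p := ⟨by
    rw [Ideal.under_def, IsScalarTower.algebraMap_eq R T (T ⧸ J), ← Ideal.comap_comap,
      Ideal.Quotient.algebraMap_eq, hcomap]
    exact Ideal.LiesOver.over⟩
  letI := Localization.AtPrime.algebraOfLiesOver p qD
  haveI : Algebra.IsUnramifiedAt R qD := isUnramifiedAt_map_mk_fittingIdeal K p q hA hJq
  haveI hsep : Algebra.IsSeparable p.ResidueField qD.ResidueField := inferInstance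
  -- `κ(q) ≅ κ(q/J)` compatibly with `κ(p)`
  have hbij := (RingHom.surjectiveOnStalks_of_surjective
    (Ideal.Quotient.mk_surjective (I := J))).residueFieldMap_bijective q qD hcomap.symm
  let e : q.ResidueField ≃+* qD.ResidueField :=
    RingEquiv.ofBijective (Ideal.ResidueField.map q qD (Ideal.Quotient.mk J) hcomap.symm) hbij
  refine Algebra.IsSeparable.of_equiv_equiv (RingEquiv.refl p.ResidueField) e.symm ?_
  -- compatibility: `e.symm ∘ (κ(p) → κ(q/J)) = (κ(p) → κ(q))`, i.e. `(κ(p) → κ(q/J)) = e ∘ (κ(p) → κ(q))`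
  have hcomp : (algebraMap p.ResidueField qD.ResidueField) =
      (e : q.ResidueField →+* qD.ResidueField).comp (algebraMap p.ResidueField q.ResidueField) := by
    apply Ideal.ResidueField.ringHom_ext
    ext r
    simp only [RingHom.comp_apply]
    rw [← IsScalarTower.algebraMap_apply, ← IsScalarTower.algebraMap_apply,
      IsScalarTower.algebraMap_apply R T q.ResidueField]
    change _ = Ideal.ResidueField.map q qD (Ideal.Quotient.mk J) hcomap.symm _
    rw [Ideal.ResidueField.map_algebraMap, IsScalarTower.algebraMap_apply R (T ⧸ J) qD.ResidueField,
      IsScalarTower.algebraMap_apply R T (T ⧸ J) r]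
    rfl
  ext x
  simp only [RingEquiv.coe_ringHom_refl, RingHom.comp_id, RingHom.coe_comp, RingEquiv.coe_toRingHom,
    Function.comp_apply]
  rw [hcomp]
  simp

end Main

end Literature.AlgebraicGeometry.Resolution

end
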